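import Summits.NavierStokesRegularity.NavierStokesRegularity.Theorems.FilamentSkeletonRssKelvinGateDefs
import Summits.NavierStokesRegularity.NavierStokesRegularity.Theorems.FilamentSkeletonRssKelvinGateRotation

/-!
# Route `FilamentSkeletonRss` · crux `TransverseReductionRJ` (stmt-NavierStokesRegularity-21221) — line `kelvin_gate`,
# stub S2 `PolynomialKelvinGate`: the rotation direction of EVERY dressed base family is an approximate kernel vector of
# the extended linearised operator `(W, Q) ↦ 𝓛W + ∇Q` modulo the ROTATED accretion modes (typed §Rate, full form)

Helper file (theorems only, `--supports stmt-NavierStokesRegularity-21221 --as helper`), in the vocabulary of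
`FilamentSkeletonRssKelvinGateDefs`.  HONEST FRAMING: bookkeeping for a HYPOTHETICAL filament-type RSS blow-up route;
nothing here bears on Navier–Stokes regularity; the stub is neither proved nor refuted here.

With `𝓡V (y) := e₃ × V(y) − DV(y)[e₃ × y]` (infinitesimal rotation of a vector field) and
`𝓡ₛP (y) := −DP(y)[e₃ × y]` (infinitesimal rotation of a scalar), this file adds to the velocity identity
`𝓛_(α,U)(𝓡U) = 𝓡(E_α U)` of `FilamentSkeletonRssKelvinGateRotation`:

* `gradient_rotScalar_eq` — the PRESSURE identity `∇(𝓡ₛP) = 𝓡(∇P)` for `C²` scalars (symmetry of the Hessian and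
  skewness of `e₃ × ·`);
* `contDiff_one_laplacian`, `contDiff_one_lerayOp` — the Laplacian and the profile operator of a `C³` field are `C¹`
  (so their infinitesimal rotations make sense pointwise; the gradient of a `C²` scalar is `C¹` by
  `PalasekTowerClayBridge.Germ.contDiff_one_gradient`, re-derived inline here to keep the import closure small);
* `lerayLin_rotField_add_gradient_rotScalar` — `𝓛_(α,U⁰)(𝓡U⁰) + ∇(𝓡ₛP⁰) = 𝓡(E_α U⁰ + ∇P⁰)` in the line's
  `lerayLin` / `lerayOp` vocabulary;
* `BaseSpec.lerayLin_rotField` — **for every dressed base family of the line (`BaseSpec`, any order `k`) and every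
  `p` in the cube, the pair `(𝓡U⁰_p, 𝓡ₛP⁰_p)` solves the linearised system with forcing `𝓡r_p + Σ_j b⁰_pj 𝓡D_pj`**,
  where `r_p = baseRes` is the residual (Y-size `≤ Cr Γ^{-k}`), provided the accretion modes are differentiable at the
  point (they are real-analytic fields; see the line card, S4).  This is the typed form of the card's §Rate risk: an
  `O(Γ^{-k})`-approximate kernel vector of `[𝓛 + ∇]` modulo `span{𝓡D_pj}` of polynomial X-size, for every `k` — to
  be fed, through an (as yet unformalised) Fredholm-index count, into the cokernel test of
  `FilamentSkeletonRssKelvinGateCokernel`.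
-/

set_option linter.dupNamespace false

noncomputable section

namespace Summit.NavierStokesRegularity.NavierStokesRegularity.Theorems.KelvinGate

open Set Function
open Literature.Analysis.FluidPDE
open scoped InnerProductSpace Laplacian ContDiff Topology

/-! ## Skewness of the generator and symmetry of the Hessian -/

/-- `⟪e₃ × a, b⟫ = −⟪a, e₃ × b⟫`: the rotation generator is skew-adjoint. -/
theorem inner_rotGenL_left_eq_neg (a b : EuclideanSpace ℝ (Fin 3)) : ⟪rotGenL a, b⟫_ℝ = -⟪a, rotGenL b⟫_ℝ := by
  rw [rotGenL_apply, rotGenL_apply, inner_rotGen_left, real_inner_comm, inner_rotGen_left]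
  ring

/-- The derivative of a scalar is the inner product with its gradient (definitional). -/
theorem fderiv_apply_eq_inner_gradient (P : EuclideanSpace ℝ (Fin 3) → ℝ) (y v : EuclideanSpace ℝ (Fin 3)) :
    fderiv ℝ P y v = ⟪gradient P y, v⟫_ℝ := by
  rw [gradient, InnerProductSpace.toDual_symm_apply]

/-- **Symmetry of the Hessian in gradient form**: `⟪D(∇P)(y) h, k⟫ = ⟪D(∇P)(y) k, h⟫` for `C²` scalars `P`
(`D(∇P)(y) h = toDual⁻¹ (D²P(y) h)` and `D²P(y)` is symmetric). -/
theorem inner_fderiv_gradient_comm {P : EuclideanSpace ℝ (Fin 3) → ℝ} (hP : ContDiff ℝ 2 P)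
    (y h k : EuclideanSpace ℝ (Fin 3)) :
    ⟪fderiv ℝ (gradient P) y h, k⟫_ℝ = ⟪fderiv ℝ (gradient P) y k, h⟫_ℝ := by
  have e : gradient P = (InnerProductSpace.toDual ℝ (EuclideanSpace ℝ (Fin 3))).symm ∘ (fderiv ℝ P) := rfl
  rw [e, LinearIsometryEquiv.comp_fderiv]
  show ⟪(InnerProductSpace.toDual ℝ (EuclideanSpace ℝ (Fin 3))).symm (fderiv ℝ (fderiv ℝ P) y h), k⟫_ℝ =
    ⟪(InnerProductSpace.toDual ℝ (EuclideanSpace ℝ (Fin 3))).symm (fderiv ℝ (fderiv ℝ P) y k), h⟫_ℝ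
  rw [InnerProductSpace.toDual_symm_apply, InnerProductSpace.toDual_symm_apply]
  exact ((hP.contDiffAt (x := y)).isSymmSndFDerivAt (by simp)).eq h k

/-! ## The pressure identity `∇(𝓡ₛP) = 𝓡(∇P)` -/

/-- **`∇(𝓡ₛP)(y) = e₃ × ∇P(y) − D(∇P)(y)[e₃ × y]`** for every `C²` scalar `P`, where `𝓡ₛP (y) = −DP(y)[e₃ × y]` is the
infinitesimal rotation of `P` about `e₃` (`= d/dθ|₀ P(R_θ⁻¹ y)`): the pressure half of the rotation covariance of the
profile system. -/
theorem gradient_rotScalar_eq (P : EuclideanSpace ℝ (Fin 3) → ℝ) (hP : ContDiff ℝ 2 P) (y : EuclideanSpace ℝ (Fin 3)) :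
    gradient (fun z => -(fderiv ℝ P z) (cross (EuclideanSpace.single 2 1) z)) y =
      cross (EuclideanSpace.single 2 1) (gradient P y) -
        fderiv ℝ (gradient P) y (cross (EuclideanSpace.single 2 1) y) := by
  simp only [cross_single_two_eq_rotGenL]
  -- rewrite the rotated scalar through the gradient
  have hS : (fun z => -(fderiv ℝ P z) (rotGenL z)) = fun z => -⟪gradient P z, rotGenL z⟫_ℝ := by
    funext z; rw [fderiv_apply_eq_inner_gradient]
  have hgc : ContDiff ℝ 1 (gradient P) :=
    (InnerProductSpace.toDual ℝ (EuclideanSpace ℝ (Fin 3))).symm.contDiff.comp (hP.fderiv_right (m := 1) le_rfl)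
  have hgd : HasFDerivAt (gradient P) (fderiv ℝ (gradient P) y) y := (hgc.differentiable (by norm_num) y).hasFDerivAt
  have hJd : HasFDerivAt (fun z : EuclideanSpace ℝ (Fin 3) => rotGenL z) rotGenL y := rotGenL.hasFDerivAt
  -- derivative of `z ↦ −⟪∇P z, J z⟫`
  have hId : HasFDerivAt (fun z => -⟪gradient P z, rotGenL z⟫_ℝ)
      (-((fderivInnerCLM ℝ (gradient P y, rotGenL y)).comp ((fderiv ℝ (gradient P) y).prod rotGenL))) y :=
    (hgd.inner ℝ hJd).neg
  rw [hS]
  apply ext_inner_right ℝ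
  intro v
  rw [← fderiv_apply_eq_inner_gradient, hId.fderiv]
  simp only [_root_.neg_apply, ContinuousLinearMap.coe_comp, Function.comp_apply,
    ContinuousLinearMap.prod_apply, fderivInnerCLM_apply, inner_sub_left, inner_rotGenL_left_eq_neg]
  rw [inner_fderiv_gradient_comm hP y v (rotGenL y)]
  ring

/-! ## Regularity of the profile operator -/

/-- The Laplacian of a `C³` vector field on `ℝ³` is `C¹` (trace of the `C¹` second derivative). -/
theorem contDiff_one_laplacian {F : Type*} [NormedAddCommGroup F] [NormedSpace ℝ F]
    {U : EuclideanSpace ℝ (Fin 3) → F} (hU : ContDiff ℝ 3 U) : ContDiff ℝ 1 (Δ U) := by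
  rw [laplacian_eq_sum_fderiv_fderiv]
  have hQc : ContDiff ℝ 1 (fderiv ℝ (fderiv ℝ U)) :=
    (hU.fderiv_right (m := 2) (by norm_num)).fderiv_right (m := 1) (by norm_num)
  exact ContDiff.sum fun i _ => (hQc.clm_apply contDiff_const).clm_apply contDiff_const

/-- The profile operator of a `C³` field is `C¹`: `y ↦ E_α(U)(y) = lerayOp α U y ∈ C¹`. -/
theorem contDiff_one_lerayOp (α : ℝ) {U : EuclideanSpace ℝ (Fin 3) → EuclideanSpace ℝ (Fin 3)} (hU : ContDiff ℝ 3 U) :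
    ContDiff ℝ 1 (lerayOp α U) := by
  have e : lerayOp α U = fun y => α • (rotGenL (U y) - fderiv ℝ U y (rotGenL y)) + (1/2:ℝ) • U y +
      (1/2:ℝ) • fderiv ℝ U y y - (Δ U) y + fderiv ℝ U y (U y) := by
    funext y; simp only [lerayOp, cross_single_two_eq_rotGenL]
  rw [e]
  have hU1 : ContDiff ℝ 1 U := hU.of_le (by norm_num)
  have hP : ContDiff ℝ 1 (fderiv ℝ U) := hU.fderiv_right (by norm_num)
  exact (((((rotGenL.contDiff.comp hU1).sub (hP.clm_apply rotGenL.contDiff)).const_smul α).add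
    (hU1.const_smul _)).add ((hP.clm_apply contDiff_id).const_smul _)).sub (contDiff_one_laplacian hU)
    |>.add (hP.clm_apply hU1)

/-! ## The rotation direction solves the linearised system (velocity + pressure) -/

/-- **`𝓛_(α,U⁰)(𝓡U⁰)(y) + ∇(𝓡ₛP⁰)(y) = 𝓡(E_α U⁰ + ∇P⁰)(y)`** for `U⁰ ∈ C³`, `P⁰ ∈ C²`, in the line's vocabulary
(`lerayLin`, `lerayOp`): the infinitesimal rotation of the pair `(U⁰, P⁰)` is mapped by the extended linearised
operator `(W, Q) ↦ 𝓛W + ∇Q` to the infinitesimal rotation of the full left side of the profile equation. -/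
theorem lerayLin_rotField_add_gradient_rotScalar (α : ℝ) {U0 : EuclideanSpace ℝ (Fin 3) → EuclideanSpace ℝ (Fin 3)}
    {P0 : EuclideanSpace ℝ (Fin 3) → ℝ} (hU : ContDiff ℝ 3 U0) (hP : ContDiff ℝ 2 P0) (y : EuclideanSpace ℝ (Fin 3)) :
    lerayLin α U0 (fun z => cross (EuclideanSpace.single 2 1) (U0 z) - fderiv ℝ U0 z (cross (EuclideanSpace.single 2 1) z)) y +
        gradient (fun z => -(fderiv ℝ P0 z) (cross (EuclideanSpace.single 2 1) z)) y =
      cross (EuclideanSpace.single 2 1) (lerayOp α U0 y + gradient P0 y) -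
        fderiv ℝ (fun z => lerayOp α U0 z + gradient P0 z) y (cross (EuclideanSpace.single 2 1) y) := by
  have h1 := lerayLin_rotField_eq_rotField_lerayOp α U0 hU y
  have h2 := gradient_rotScalar_eq P0 hP y
  have hEd : DifferentiableAt ℝ (lerayOp α U0) y := (contDiff_one_lerayOp α hU).differentiable (by norm_num) y
  have hGd : DifferentiableAt ℝ (gradient P0) y :=
    ((InnerProductSpace.toDual ℝ (EuclideanSpace ℝ (Fin 3))).symm.contDiff.comp
      (hP.fderiv_right (m := 1) le_rfl)).differentiable (by norm_num) y
  rw [fderiv_fun_add hEd hGd]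
  have e1 : lerayLin α U0 (fun z => cross (EuclideanSpace.single 2 1) (U0 z) -
      fderiv ℝ U0 z (cross (EuclideanSpace.single 2 1) z)) y =
      cross (EuclideanSpace.single 2 1) (lerayOp α U0 y) - fderiv ℝ (lerayOp α U0) y (cross (EuclideanSpace.single 2 1) y) := by
    have e : lerayOp α U0 = fun z => α • (cross (EuclideanSpace.single 2 1) (U0 z) -
        fderiv ℝ U0 z (cross (EuclideanSpace.single 2 1) z)) + (1/2:ℝ) • U0 z + (1/2:ℝ) • fderiv ℝ U0 z z -
        (Δ U0) z + fderiv ℝ U0 z (U0 z) := rfl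
    rw [e]
    exact h1
  rw [e1, h2]
  simp only [← crossCLM_apply, map_add, _root_.add_apply]
  abel

/-- Linearity of the infinitesimal rotation on a residual decomposition: if `G = r + Σ_j b_j D_j` pointwise with `r`
and every `D_j` differentiable at `y`, then `𝓡G(y) = 𝓡r(y) + Σ_j b_j 𝓡D_j(y)`. -/
theorem rotField_of_eq_add_sum {N : ℕ} {G r : EuclideanSpace ℝ (Fin 3) → EuclideanSpace ℝ (Fin 3)}
    {Dm : Fin N → EuclideanSpace ℝ (Fin 3) → EuclideanSpace ℝ (Fin 3)} {b : Fin N → ℝ} {y : EuclideanSpace ℝ (Fin 3)}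
    (heq : ∀ z, G z = r z + ∑ j, b j • Dm j z) (hr : DifferentiableAt ℝ r y) (hD : ∀ j, DifferentiableAt ℝ (Dm j) y) :
    cross (EuclideanSpace.single 2 1) (G y) - fderiv ℝ G y (cross (EuclideanSpace.single 2 1) y) =
      (cross (EuclideanSpace.single 2 1) (r y) - fderiv ℝ r y (cross (EuclideanSpace.single 2 1) y)) +
      ∑ j, b j • (cross (EuclideanSpace.single 2 1) (Dm j y) - fderiv ℝ (Dm j) y (cross (EuclideanSpace.single 2 1) y)) := by
  have hG : G = fun z => r z + ∑ j, b j • Dm j z := funext heq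
  have hS : HasFDerivAt (fun z => ∑ j, b j • Dm j z) (∑ j, b j • fderiv ℝ (Dm j) y) y :=
    HasFDerivAt.fun_sum fun j _ => ((hD j).hasFDerivAt.const_smul (b j))
  rw [hG, fderiv_fun_add hr hS.differentiableAt, hS.fderiv]
  simp only [← crossCLM_apply, map_add, map_sum, map_smul, _root_.add_apply, FunLike.coe_sum, Finset.sum_apply,
    _root_.smul_apply, smul_sub, Finset.sum_sub_distrib]
  abel

/-- **Typed §Rate (full form): for every dressed base family, the rotation direction is an approximate kernel vector of
the extended linearisation modulo the rotated accretion modes.**  If `(U⁰, P⁰, b⁰)` satisfies the line's `BaseSpec`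
(any order `k`, constants `Cs, Cr`), then at every `p` in the cube and every point `y` where the accretion modes
`D_pj` are differentiable,
`𝓛_(α_p,U⁰_p)(𝓡U⁰_p)(y) + ∇(𝓡ₛP⁰_p)(y) = 𝓡r_p(y) + Σ_j b⁰_pj 𝓡D_pj(y)`,
with `r_p = baseRes α D U⁰ P⁰ b⁰ p` the residual, whose Y-size is `≤ Cr Γ^{-k}` by `BaseSpec`.  (`U⁰_p ∈ C^∞`,
`P⁰_p ∈ C^∞` and `r_p ∈ C¹` are part of `BaseSpec`; differentiability of `D_pj` holds for the crux's real-analytic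
modes but is kept as an explicit hypothesis here.) -/
theorem BaseSpec.lerayLin_rotField {N : ℕ} {Γ ρ η Rw : ℝ} {k : ℕ} {Cs Cr : ℝ} {α : (Fin N → ℝ) → ℝ}
    {X : (Fin N → ℝ) → Fin N → ℝ → EuclideanSpace ℝ (Fin 3)}
    {u : (Fin N → ℝ) → (Fin N → ℝ → EuclideanSpace ℝ (Fin 3)) → EuclideanSpace ℝ (Fin 3) → EuclideanSpace ℝ (Fin 3)}
    {D : (Fin N → ℝ) → Fin N → EuclideanSpace ℝ (Fin 3) → EuclideanSpace ℝ (Fin 3)}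
    {U0 : (Fin N → ℝ) → EuclideanSpace ℝ (Fin 3) → EuclideanSpace ℝ (Fin 3)} {P0 : (Fin N → ℝ) → EuclideanSpace ℝ (Fin 3) → ℝ}
    {b0 : (Fin N → ℝ) → Fin N → ℝ} (h : BaseSpec N Γ ρ η Rw k Cs Cr α X u D U0 P0 b0)
    {p : Fin N → ℝ} (hp : ∀ i, p i ∈ Icc (0:ℝ) 1) {y : EuclideanSpace ℝ (Fin 3)} (hD : ∀ j, DifferentiableAt ℝ (D p j) y) :
    lerayLin (α p) (U0 p) (fun z => cross (EuclideanSpace.single 2 1) (U0 p z) -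
          fderiv ℝ (U0 p) z (cross (EuclideanSpace.single 2 1) z)) y +
        gradient (fun z => -(fderiv ℝ (P0 p) z) (cross (EuclideanSpace.single 2 1) z)) y =
      (cross (EuclideanSpace.single 2 1) (baseRes α D U0 P0 b0 p y) -
          fderiv ℝ (baseRes α D U0 P0 b0 p) y (cross (EuclideanSpace.single 2 1) y)) +
      ∑ j, b0 p j • (cross (EuclideanSpace.single 2 1) (D p j y) - fderiv ℝ (D p j) y (cross (EuclideanSpace.single 2 1) y)) := by
  obtain ⟨hU, hP, -, -, -, -, -, -, hY, -⟩ := h.2 p hp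
  have hU3 : ContDiff ℝ 3 (U0 p) := hU.of_le (by norm_cast)
  have hP2 : ContDiff ℝ 2 (P0 p) := hP.of_le (by norm_cast)
  rw [lerayLin_rotField_add_gradient_rotScalar (α p) hU3 hP2 y]
  have heq : ∀ z, lerayOp (α p) (U0 p) z + gradient (P0 p) z = baseRes α D U0 P0 b0 p z + ∑ j, b0 p j • D p j z := by
    intro z; simp only [baseRes, sub_add_cancel]
  exact rotField_of_eq_add_sum (G := fun z => lerayOp (α p) (U0 p) z + gradient (P0 p) z) heq
    (hY.1.differentiable (by norm_num) y) hD

end Summit.NavierStokesRegularity.NavierStokesRegularity.Theorems.KelvinGate
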